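import Literature.Probability.LatticeModels.ONModelProofs
import Literature.Probability.LatticeModels.ONModelSpecification
import Literature.Probability.LatticeModels.GibbsSpecificationDLRProofs
import HarnessLib

/-!
# The O(N) model: global `O(N)` symmetry of the specification and of the Gibbs measures

Sibling proof file of `Literature/Probability/LatticeModels/ONModel.lean` /
`ONModelProofs.lean` (which treat the free boundary condition). No definition and no named fact
is introduced (D-0026); everything here is proved.

* `onSpecification_map_rotate`: the O(N) kernels are `O(N)`-equivariant,
  `γ_Λ(· | η) ∘ (rotate R)⁻¹ = γ_Λ(· | rotate R η)` for every linear isometry `R` of `ℝ^N` — the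
  a priori measure and the interaction `⟪s_x, s_y⟫` are `O(N)`-invariant (Friedli–Velenik 2017,
  §9.1 eq. (9.3) with §6.6, `G`-invariant specifications).
* `IsGibbsMeasure.map_of_kernel_map_eq`: for any specification, the push-forward of a Gibbs
  measure under a measurable map intertwining the kernels is a Gibbs measure
  (Friedli–Velenik 2017, §6.6; Georgii 2011, Ch. 5).
* `isGibbsMeasure_map_rotate`, `map_rotate_eq_of_subsingleton`: hence `𝒢(γ^{O(N)}_β)` is
  `O(N)`-invariant, and when `|𝒢| ≤ 1` the Gibbs measure is `O(N)`-invariant; in particular every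
  spin coordinate has mean zero, `μ((s x)_i) = 0` (`integral_spinCoord_eq_zero_of_subsingleton`).

## References

* S. Friedli, Y. Velenik, *Statistical Mechanics of Lattice Systems*, CUP (2017), §6.6 (symmetries
  of specifications and of `𝒢(π)`), §9.1 eq. (9.2)–(9.3) (O(N)-invariance of the N-vector models).
* H.-O. Georgii, *Gibbs Measures and Phase Transitions*, 2nd ed. (2011), Ch. 5 (symmetries,
  transformation of specifications) — context only, as cited by the sibling files; not re-read here.
-/

noncomputable section

open MeasureTheory Finset Function
open scoped RealInnerProductSpace ENNReal

namespace Literature.Probability.LatticeModels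

variable {V : Type*} {N : ℕ}

/-! ### Push-forwards of Gibbs measures under kernel-intertwining maps -/

section PushForward

variable {S : Type*} [MeasurableSpace S] {γ : Specification V S}

/-- **Push-forward of a Gibbs measure under a symmetry of the specification** (Friedli–Velenik
2017, §6.6: if the specification is `G`-invariant then so is `𝒢(π)`; Georgii 2011, Ch. 5): for a
specification `γ`, a measurable `T : (V → S) → (V → S)` with `γ_Λ(· | η) ∘ T⁻¹ = γ_Λ(· | T η)` for
all `Λ, η`, and `μ ∈ 𝒢(γ)`, also `μ ∘ T⁻¹ ∈ 𝒢(γ)`. [cite: FriedliVelenik2017, §6.6] -/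
theorem IsGibbsMeasure.map_of_kernel_map_eq (hγ : IsSpecification γ) {μ : Measure (V → S)}
    (hμ : IsGibbsMeasure γ μ) {T : (V → S) → (V → S)} (hT : Measurable T)
    (hγT : ∀ (Λ : Finset V) (η : V → S), (γ Λ η).map T = γ Λ (T η)) :
    IsGibbsMeasure γ (μ.map T) := by
  haveI := hμ.isProbabilityMeasure
  refine ⟨Measure.isProbabilityMeasure_map hT.aemeasurable, fun Λ A hA => ?_⟩
  rw [lintegral_map (hγ.measurable_coe Λ hA) hT, Measure.map_apply hT hA]
  have hpt : (fun η => γ Λ (T η) A) = fun η => γ Λ η (T ⁻¹' A) := funext fun η => by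
    rw [← hγT Λ η, Measure.map_apply hT hA]
  rw [hpt]
  exact hμ.2 Λ (T ⁻¹' A) (hT hA)

end PushForward

/-! ### `O(N)`-equivariance of the O(N) kernels -/

section Rotate

variable (G : SimpleGraph V) [DecidableEq V] [G.LocallyFinite] [NeZero N]
  (R : EuclideanSpace ℝ (Fin N) ≃ₗᵢ[ℝ] EuclideanSpace ℝ (Fin N))

omit [DecidableEq V] [G.LocallyFinite] in
/-- Rotating a glued configuration is gluing the rotated pieces:
`rotate R (ζ η_{Λᶜ}) = (rotate R ζ) (rotate R η)_{Λᶜ}`. [folklore] -/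
private theorem rotate_onGlue_fixed (Λ : Finset V) (ζ : ↥Λ → SphereSpin N) (η : ONConfig V N) :
    ONConfig.rotate R (onGlue Λ ζ (.fixed η)) =
      onGlue Λ (ONConfig.rotate R ζ) (.fixed (ONConfig.rotate R η)) := by
  funext x
  apply Subtype.ext
  by_cases hx : x ∈ Λ
  · simp [onGlue, hx]
  · simp [onGlue, hx]

omit [NeZero N] in
/-- The fixed-boundary Hamiltonian is `O(N)`-invariant:
`H^{Rη}_Λ(R s) = H^{η}_Λ(s)` — indeed `⟪R u, R v⟫ = ⟪u, v⟫`, and the `bc` slot only selects the edge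
set `ℰ^b_Λ` (Friedli–Velenik 2017, eq. (9.3)). [cite: FriedliVelenik2017, eq. (9.3)] -/
theorem onHamiltonian_fixed_rotate (Λ : Finset V) (η η' s : ONConfig V N) :
    onHamiltonian G Λ (.fixed η') (ONConfig.rotate R s) = onHamiltonian G Λ (.fixed η) s := by
  rw [onHamiltonian_fixed, onHamiltonian_fixed]
  simp [onBond_rotate]

/-- **`O(N)`-equivariance of the O(N) specification**: for every linear isometry `R` of `ℝ^N`,
`γ_Λ(· | η) ∘ (rotate R)⁻¹ = γ_Λ(· | rotate R η)` — the product of uniform sphere measures is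
rotation invariant and the Boltzmann weight is `O(N)`-invariant (Friedli–Velenik 2017, §9.1
eq. (9.3) with §6.6). [cite: FriedliVelenik2017, §9.1 eq. (9.3) with §6.6] -/
theorem onSpecification_map_rotate (β : ℝ) (Λ : Finset V) (η : ONConfig V N) :
    (onSpecification G β Λ η).map (ONConfig.rotate R) =
      onSpecification G β Λ (ONConfig.rotate R η) := by
  have hΦ : Measurable (ONConfig.rotate (V := V) R) := ONConfig.measurable_rotate R
  simp only [onSpecification_apply, onMeasure]
  -- the tilt function is `O(N)`-invariant and does not see the boundary configuration
  set g : ONConfig V N → ℝ := fun s => -β * onHamiltonian G Λ (.fixed (ONConfig.rotate R η)) s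
    with hg
  have hgm : Measurable g := (measurable_onHamiltonian G Λ _).const_mul _
  have hg_eq : (fun s => -β * onHamiltonian G Λ (.fixed η) s) = g ∘ ONConfig.rotate R :=
    funext fun s => by
      simp only [hg, Function.comp_apply, onHamiltonian_fixed_rotate G R Λ η]
  rw [hg_eq, map_tilted_comp _ hΦ hgm, Measure.map_map hΦ (measurable_onGlue Λ _)]
  -- the glued reference measure is pushed to the glued reference measure of the rotated boundary
  have hcomp : ONConfig.rotate R ∘ (fun ζ : ↥Λ → SphereSpin N => onGlue Λ ζ (.fixed η)) =
      (fun ζ : ↥Λ → SphereSpin N => onGlue Λ ζ (.fixed (ONConfig.rotate R η))) ∘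
        ONConfig.rotate (V := ↥Λ) R :=
    funext fun ζ => rotate_onGlue_fixed R Λ ζ η
  rw [hcomp, ← Measure.map_map (measurable_onGlue Λ _) (ONConfig.measurable_rotate R),
    (measurePreserving_onReference_rotate Λ R).map_eq]

variable [Countable V]

/-- **`𝒢(γ^{O(N)}_β)` is `O(N)`-invariant**: the push-forward of a Gibbs measure of the O(N)
model under a global rotation `R ∈ O(N)` is again a Gibbs measure (Friedli–Velenik 2017, §6.6
with §9.1). [cite: FriedliVelenik2017, §6.6 with §9.1] -/
theorem isGibbsMeasure_map_rotate (β : ℝ) {μ : Measure (ONConfig V N)}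
    (hμ : IsGibbsMeasure (onSpecification G β) μ) :
    IsGibbsMeasure (onSpecification G β) (μ.map (ONConfig.rotate R)) :=
  hμ.map_of_kernel_map_eq (isSpecification_onSpecification_countable G β)
    (ONConfig.measurable_rotate R) (onSpecification_map_rotate G R β)

/-- **In the uniqueness regime the Gibbs measure is `O(N)`-invariant**: if `|𝒢(γ^{O(N)}_β)| ≤ 1`
and `μ ∈ 𝒢`, then `μ ∘ (rotate R)⁻¹ = μ` for every `R ∈ O(N)` (Friedli–Velenik 2017, §6.6:
a unique Gibbs measure inherits every symmetry of the specification). [cite: FriedliVelenik2017, §6.6] -/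
theorem map_rotate_eq_of_subsingleton (β : ℝ)
    (hsub : (gibbsMeasures (onSpecification (N := N) G β)).Subsingleton)
    {μ : Measure (ONConfig V N)} (hμ : IsGibbsMeasure (onSpecification G β) μ) :
    μ.map (ONConfig.rotate R) = μ :=
  hsub (isGibbsMeasure_map_rotate G R β hμ) hμ

end Rotate

/-! ### Vanishing of the magnetisation in the uniqueness regime -/

section Magnetisation

variable (G : SimpleGraph V) [DecidableEq V] [G.LocallyFinite] [NeZero N] [Countable V]

/-- **Zero magnetisation in the uniqueness regime**: if `|𝒢(γ^{O(N)}_β)| ≤ 1` and `μ ∈ 𝒢`, then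
every spin coordinate has mean zero, `∫ (s x)_i dμ = 0` — apply the invariance under the global
spin flip `R = -1 ∈ O(N)` (Friedli–Velenik 2017, §6.6 with §9.1; the Mermin–Wagner chapter's
standing remark that symmetric unique states have no magnetisation). [cite: FriedliVelenik2017, §6.6 with §9.1] -/
theorem integral_spinCoord_eq_zero_of_subsingleton (β : ℝ)
    (hsub : (gibbsMeasures (onSpecification (N := N) G β)).Subsingleton)
    {μ : Measure (ONConfig V N)} (hμ : IsGibbsMeasure (onSpecification G β) μ) (x : V) (i : Fin N) :
    ∫ s, (s x : EuclideanSpace ℝ (Fin N)) i ∂μ = 0 := by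
  set R : EuclideanSpace ℝ (Fin N) ≃ₗᵢ[ℝ] EuclideanSpace ℝ (Fin N) := LinearIsometryEquiv.neg ℝ
    with hR
  have hinv := map_rotate_eq_of_subsingleton G R β hsub hμ
  have hf : Measurable fun s : ONConfig V N => (s x : EuclideanSpace ℝ (Fin N)) i := by
    have h : Continuous fun s : ONConfig V N => (s x : EuclideanSpace ℝ (Fin N)) :=
      (continuous_apply x).subtype_val
    have h2 : Continuous fun s : ONConfig V N =>
        (EuclideanSpace.proj i : EuclideanSpace ℝ (Fin N) →L[ℝ] ℝ) (s x : EuclideanSpace ℝ (Fin N)) :=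
      (EuclideanSpace.proj i).continuous.comp h
    exact h2.measurable
  -- `∫ (s x)_i dμ = ∫ (s x)_i d(μ ∘ R⁻¹) = ∫ ((R s) x)_i dμ = -∫ (s x)_i dμ`
  have h1 : ∫ s, (s x : EuclideanSpace ℝ (Fin N)) i ∂μ =
      ∫ s, (ONConfig.rotate R s x : EuclideanSpace ℝ (Fin N)) i ∂μ := by
    conv_lhs => rw [← hinv]
    exact integral_map (ONConfig.measurable_rotate R).aemeasurable hf.aestronglyMeasurable
  have h2 : ∀ s : ONConfig V N,
      (ONConfig.rotate R s x : EuclideanSpace ℝ (Fin N)) i = -((s x : EuclideanSpace ℝ (Fin N)) i) :=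
    fun s => by
      rw [ONConfig.coe_rotate_apply, hR, LinearIsometryEquiv.coe_neg]
      rfl
  simp_rw [h2, integral_neg] at h1
  linarith

end Magnetisation

end Literature.Probability.LatticeModels
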